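import Summits.BirchSwinnertonDyer.Rank1Residual.Additive.QuadraticBranchMinusLFunctionUnique
import HarnessLib

/-!
# Kobayashi's PLUS function on the quadratic branch is determined up to a unit by its
# interpolation property; hence the ideals `(L_p^±(V, η, X))` of the branch main conjectures are
# choice-free (proofs only; cell `b2b-bsdres`, CLASS-CLOSURE lane, seat x1b GEN 29)

HONEST FRAMING (cell `b2b-bsdres`, run/shared/lean/b2b/bsd-rank1-residual/, verbatim in every
file): the goal of the cell is to DELETE the COMBINATION-SHAPED residual classes of the
Birch–Swinnerton-Dyer formula for ALL analytic-rank `≤ 1` elliptic curves over `ℚ` — "full BSD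
formula for every rank `≤ 1` curve in class `C`" assembled STRICTLY from published theorems — so
that the rank-`≤ 1` remainder becomes exactly the CONSTRUCTION-SHAPED classes, which are TYPED
(missing-input `Prop`s), NOT attempted. This is not "finishing BSD". This file: THEOREMS ONLY (no
definition, no named fact, no axiom; net debt `0`); nothing is booked; no label moves; nothing about
any curve is asserted.

The sibling file `QuadraticBranchMinusLFunctionUnique.lean` proves that two solutions of the
MINUS predicate `IsQuadraticBranchMinusLFunction f p ϖ ·` (Kobayashi (3.5), odd levels) differ by a
unit of `ℤ_p`. The same argument at EVEN levels `n = 2k + 2` gives the statement for the PLUS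
predicate `IsQuadraticBranchPlusLFunction f p ϖ ·` (Kobayashi (3.4); cc-typer-6,
`QuadraticBranchSignedMainConjecture.lean`), which is the `Lη` of the typed conjecture-in-print
`QuadraticBranchPlusMainConjectureAt` ((C1_η): `Char X⁺(V/F_∞) = Char X⁺(V/ℚ_∞) · (L_p⁺(V, η, X))`,
quantified over EVERY such `Lη`). Consequence recorded here: the principal ideals `(L)` — the only
thing a characteristic-ideal statement sees — do not depend on the choice of `L`, for both signs
(`…span_singleton_eq`). So (C1_η) as typed is exactly Kobayashi's printed conjecture for his
`L_p⁺(V, η, X)`, neither weaker nor stronger on this count.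

References: [Kobayashi2003] Thm. 3.2, (3.4)–(3.7) (p. 7), §4 (p. 8); [Pollack2003] Prop. 6.9;
[MazurTateTeitelbaum1986Invent] §I.12–I.14.
-/

noncomputable section

open scoped Classical MatrixGroups ModularForm

open CongruenceSubgroup Polynomial Literature.NumberTheory.EllipticCurves
  Literature.NumberTheory.EllipticCurves.ModularForms

namespace Summit.BirchSwinnertonDyer.Rank1Residual.Additive

variable {p : ℕ} [hp : Fact p.Prime] {N : ℕ} {f : CuspForm (Gamma0 N) 2}

/-- **Two solutions of Kobayashi's quadratic-branch interpolation property (3.4) (PLUS sign, even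
levels) differ by a unit of `ℤ_p`** (`p` odd). Same proof as the minus sign, along the even levels
`n = 2k + 2`. [cite: Kobayashi2003, Thm. 3.2 and (3.4), (3.6) (p. 7)]
[cite: Pollack2003, Prop. 6.9 (proof) and §3] [cite: MazurTateTeitelbaum1986Invent, §I.12–I.14] -/
theorem IsQuadraticBranchPlusLFunction.exists_units_smul_eq (hp2 : p ≠ 2) {ϖ : ℚ}
    {L₁ L₂ : IwasawaAlgebra p} (h₁ : IsQuadraticBranchPlusLFunction f p ϖ L₁)
    (h₂ : IsQuadraticBranchPlusLFunction f p ϖ L₂) :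
    ∃ v : ℤ_[p]ˣ, L₂ = (v : ℤ_[p]) • L₁ := by
  have hP : p.Prime := hp.out
  obtain ⟨u₁, H₁⟩ := h₁
  obtain ⟨u₂, H₂⟩ := h₂
  set D : IwasawaAlgebra p := (u₂ : ℤ_[p]) • L₁ - (u₁ : ℤ_[p]) • L₂ with hDdef
  suffices hD0 : D = 0 by
    refine ⟨u₁⁻¹ * u₂, ?_⟩
    have h : (u₁ : ℤ_[p]) • L₂ = (u₂ : ℤ_[p]) • L₁ := (sub_eq_zero.mp hD0).symm
    calc L₂ = ((u₁⁻¹ * u₁ : ℤ_[p]ˣ) : ℤ_[p]) • L₂ := by rw [inv_mul_cancel, Units.val_one, one_smul]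
      _ = ((u₁⁻¹ : ℤ_[p]ˣ) : ℤ_[p]) • ((u₁ : ℤ_[p]) • L₂) := by rw [Units.val_mul, mul_smul]
      _ = ((u₁⁻¹ * u₂ : ℤ_[p]ˣ) : ℤ_[p]) • L₁ := by rw [h, ← mul_smul, ← Units.val_mul]
  by_contra hD
  have hD' : iwasawaToPowerSeries p D ≠ 0 := fun h0 ↦
    hD (iwasawaToPowerSeries_injective p (by rw [h0, map_zero]))
  have hfin := MemIwasawaRat.finite_setOf_hasSum_zero (memIwasawaRat_iwasawaToPowerSeries p D) hD'
  -- even levels `n_k = 2k + 2`, points `ζ_k` of order `p^{n_k}`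
  choose ζ hζ using fun k : ℕ ↦ exists_isPrimitiveRoot_padicComplex' (p := p) (2 * k + 2)
  choose ψ hψ using fun k : ℕ ↦
    exists_dirichletCharacter_orderOf_two_mul_prime_pow hp2 (Nat.succ_pos (2 * k + 1)) (hζ k)
  set ι : ℤ_[p] →+* ℂ_[p] := (algebraMap ℚ_[p] ℂ_[p]).comp (algebraMap ℤ_[p] ℚ_[p]) with hι
  have hcoe : ∀ (L : IwasawaAlgebra p) (k : ℕ),
      algebraMap ℚ_[p] ℂ_[p] (PowerSeries.coeff k (iwasawaToPowerSeries p L)) =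
        ι (PowerSeries.coeff k L) := by
    intro L k
    simp only [hι, RingHom.comp_apply, iwasawaToPowerSeries, PowerSeries.coeff_map]
  have hcoeffD : ∀ k, PowerSeries.coeff k D =
      (u₂ : ℤ_[p]) * PowerSeries.coeff k L₁ - (u₁ : ℤ_[p]) * PowerSeries.coeff k L₂ := by
    intro k
    rw [hDdef, map_sub, PowerSeries.coeff_smul, PowerSeries.coeff_smul, smul_eq_mul, smul_eq_mul]
  have hmem : ∀ k, ζ k - 1 ∈ {z : ℂ_[p] | ‖z‖ < 1 ∧
      HasSum (fun j ↦ algebraMap ℚ_[p] ℂ_[p] (PowerSeries.coeff j (iwasawaToPowerSeries p D)) *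
        z ^ j) 0} := by
    intro k
    have hz : ‖ζ k - 1‖ < 1 := norm_sub_one_lt_one_of_pow_prime_pow_eq_one (hζ k).pow_eq_one
    refine ⟨hz, ?_⟩
    have e₁ := H₁ (2 * k + 2) ⟨k + 1, by ring⟩ (ψ k) (hψ k).1
    have e₂ := H₂ (2 * k + 2) ⟨k + 1, by ring⟩ (ψ k) (hψ k).1
    rw [(hψ k).2] at e₁ e₂
    have hsub := (e₁.mul_left (ι u₂)).sub (e₂.mul_left (ι u₁))
    have hrhs : ι (u₂ : ℤ_[p]) * ((-1 : ℂ_[p]) ^ ((2 * k + 2) / 2 + 1) *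
          algebraMap ℚ_[p] ℂ_[p] (((u₁ : ℤ_[p]) : ℚ_[p]) * (ϖ : ℚ_[p])) *
          (if Even (p / 2) then ratTwistedSymbolSum f (ψ k) else ratMinusTwistedSymbolSum f (ψ k)) /
        (cyclotomicOmegaMinus p (2 * k + 2)).eval₂ (algebraMap ℤ ℂ_[p]) (ζ k - 1)) -
        ι (u₁ : ℤ_[p]) * ((-1 : ℂ_[p]) ^ ((2 * k + 2) / 2 + 1) *
          algebraMap ℚ_[p] ℂ_[p] (((u₂ : ℤ_[p]) : ℚ_[p]) * (ϖ : ℚ_[p])) *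
          (if Even (p / 2) then ratTwistedSymbolSum f (ψ k) else ratMinusTwistedSymbolSum f (ψ k)) /
        (cyclotomicOmegaMinus p (2 * k + 2)).eval₂ (algebraMap ℤ ℂ_[p]) (ζ k - 1)) = 0 := by
      have hu : ∀ u : ℤ_[p]ˣ, algebraMap ℚ_[p] ℂ_[p] (((u : ℤ_[p]) : ℚ_[p]) * (ϖ : ℚ_[p])) =
          ι (u : ℤ_[p]) * algebraMap ℚ_[p] ℂ_[p] (ϖ : ℚ_[p]) := by
        intro u
        rw [map_mul, hι, RingHom.comp_apply, PadicInt.algebraMap_apply]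
      rw [hu u₁, hu u₂]
      ring
    rw [hrhs] at hsub
    have hfun : (fun j ↦ algebraMap ℚ_[p] ℂ_[p] (PowerSeries.coeff j (iwasawaToPowerSeries p D)) *
        (ζ k - 1) ^ j) = fun j ↦
        ι (u₂ : ℤ_[p]) * (ι (PowerSeries.coeff j L₁) * (ζ k - 1) ^ j) -
          ι (u₁ : ℤ_[p]) * (ι (PowerSeries.coeff j L₂) * (ζ k - 1) ^ j) := by
      funext j
      rw [hcoe, hcoeffD, map_sub, map_mul, map_mul]
      ring
    rw [hfun]
    exact hsub
  have hinjζ : Function.Injective fun k ↦ ζ k - 1 := by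
    intro a b hab
    have hζab : ζ a = ζ b := sub_left_injective hab
    have ho : p ^ (2 * a + 2) = p ^ (2 * b + 2) := by
      rw [(hζ a).eq_orderOf, (hζ b).eq_orderOf, hζab]
    have := Nat.pow_right_injective hP.two_le ho
    omega
  exact hfin.not_infinite
    ((Set.infinite_range_of_injective hinjζ).mono (Set.range_subset_iff.mpr hmem))

/-- **The ideal `(L_p⁺(V, η, X))` of the even branch main conjecture (C1_η) is choice-free**: any two
solutions of (3.4) generate the same principal ideal of `Λ`. So the typed
`QuadraticBranchPlusMainConjectureAt`, which quantifies over every `Lη` with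
`IsQuadraticBranchPlusLFunction f p ϖ Lη`, is Kobayashi's printed Even main conjecture for his
function and nothing more. [cite: Kobayashi2003, §4 Even main conjecture (p. 8) and (3.4) (p. 7)] -/
theorem IsQuadraticBranchPlusLFunction.span_singleton_eq (hp2 : p ≠ 2) {ϖ : ℚ}
    {L₁ L₂ : IwasawaAlgebra p} (h₁ : IsQuadraticBranchPlusLFunction f p ϖ L₁)
    (h₂ : IsQuadraticBranchPlusLFunction f p ϖ L₂) :
    Ideal.span ({L₁} : Set (IwasawaAlgebra p)) = Ideal.span {L₂} := by
  obtain ⟨v, hv⟩ := h₁.exists_units_smul_eq hp2 h₂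
  rw [hv, Algebra.smul_def]
  exact (Ideal.span_singleton_mul_left_unit ((v.map (algebraMap ℤ_[p] (IwasawaAlgebra p) :
    ℤ_[p] →* IwasawaAlgebra p)).isUnit) L₁).symm

/-- **The ideal `(L_p⁻(V, η, X))` — and hence `(X⁻¹L_p⁻(V, η, X))` — of the odd branch main
conjecture is choice-free** (minus sign; from the sibling file's uniqueness).
[cite: Kobayashi2003, §4 Odd main conjecture (p. 8) and (3.5), (3.7) (p. 7)] -/
theorem IsQuadraticBranchMinusLFunction.span_singleton_eq (hp2 : p ≠ 2) {ϖ : ℚ}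
    {L₁ L₂ : IwasawaAlgebra p} (h₁ : IsQuadraticBranchMinusLFunction f p ϖ L₁)
    (h₂ : IsQuadraticBranchMinusLFunction f p ϖ L₂) :
    Ideal.span ({L₁} : Set (IwasawaAlgebra p)) = Ideal.span {L₂} := by
  obtain ⟨v, hv⟩ := h₁.exists_units_smul_eq hp2 h₂
  rw [hv, Algebra.smul_def]
  exact (Ideal.span_singleton_mul_left_unit ((v.map (algebraMap ℤ_[p] (IwasawaAlgebra p) :
    ℤ_[p] →* IwasawaAlgebra p)).isUnit) L₁).symm

/-- **The constant term `L_p⁺(V, η, 0)` is determined up to a unit** (it is the (3.6) quantity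
`−(p/τ(η̄))·L(V, η̄, 1)/Ω` for Kobayashi's function; here: choice-free up to `ℤ_p^×`, so in
particular `L(0) = 0 ↔ L'(0) = 0` — the analytic-rank-zero reading on the branch is choice-free).
[cite: Kobayashi2003, (3.6) (p. 7)] -/
theorem IsQuadraticBranchPlusLFunction.constantCoeff_eq_zero_iff (hp2 : p ≠ 2) {ϖ : ℚ}
    {L₁ L₂ : IwasawaAlgebra p} (h₁ : IsQuadraticBranchPlusLFunction f p ϖ L₁)
    (h₂ : IsQuadraticBranchPlusLFunction f p ϖ L₂) :
    PowerSeries.constantCoeff L₁ = 0 ↔ PowerSeries.constantCoeff L₂ = 0 := by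
  obtain ⟨v, hv⟩ := h₁.exists_units_smul_eq hp2 h₂
  rw [hv, ← PowerSeries.coeff_zero_eq_constantCoeff_apply, ← PowerSeries.coeff_zero_eq_constantCoeff_apply,
    PowerSeries.coeff_smul, smul_eq_mul, Units.mul_right_eq_zero]

end Summit.BirchSwinnertonDyer.Rank1Residual.Additive

end
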